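import Literature.MathematicalPhysics.QuantumFieldTheory.SpectralDefectDensity
import Summits.QuantumFields.QCD.Theorems.WindowExtinction.Negative.SpectralFlowLocal

/-!
# The IMS partition of unity on the torus and the trace count (support for stub `stub_imsColdBoxes`)
(line `covariant-laplacian-floor`, crux `Summit.QuantumFields.QCD.Theses.SpectralDefectExtinction.TipPricing`,
item stmt-QuantumFields-8967)

Two `U`-free ingredients of the IMS cold-box count, Mathlib + tree vocabulary only (`TorusSite`, `box`,
`Torus.proj`, `ZMod.valMinAbs`, `Matrix.IsHermitian.eigenvectorUnitary`):

* **The partition of unity** (`stub_imsPartition`, registered sub-goal; proof `ims_tent`).  On the torus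
  `(ℤ/(2S+1))⁴` and for a radius `1 ≤ R`, `R + 1 ≤ S`, the product tent
  `ω(x) = ∏_i (R + 1 − |x_i|)₊` (`|x_i|` the symmetric representative `valMinAbs`) has `Σ ω² > 0`, is
  supported in the image of the box `{−R,…,R}⁴` under `Torus.proj`, and its lattice IMS error in every
  direction obeys `0 ≤ Σ_x ω(x)² − Σ_x ω(x)ω(x+e_μ) ≤ (3/R²) Σ_x ω(x)²`: by the product structure this is the
  one-dimensional computation `Σ_z τ² − Σ_z τ(z)τ(z+1) = ½ Σ_z (τ(z+1) − τ(z))² ≤ R + 1` (the tent is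
  `1`-Lipschitz along `z ↦ z + 1` and changes on at most `2R + 2` residues) against
  `Σ_z τ(z)² ≥ Σ_{j=0}^{R} (R+1−j)² ≥ (R+1)³/3`.
* **The trace count** (`ims_count`).  If every vector with `Re⟨v, Av⟩ ≤ E‖v‖²` (`A` Hermitian) has
  `c‖v‖² ≤ Σ_i B(i)|v_i|²` for a non-negative diagonal `B`, then `c · #{λ(A) < E} ≤ Σ_i B(i)`: apply the
  hypothesis to the orthonormal eigenvectors below `E` and use `Σ_j |e_j(i)|² = 1` (unitarity of
  `eigenvectorUnitary`) — the elementary form of `tr(P_V B P_V) ≤ tr B`.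

Also two quadratic-form one-liners (`ims_form_conjTranspose`, `ims_re_form_le_of_isometry`).
References for the mathematics: the lattice IMS localisation formula as used for Lifshitz tails, W. Kirsch,
B. Metzger, *The integrated density of states for random Schrödinger operators*, Proc. Sympos. Pure Math. 76
(2007) §5 (arXiv:math-ph/0608066); trace/variational counting, Reed–Simon IV §XIII.1.  No definitions, no
named facts.
-/

namespace Summit.QuantumFields.QCD.Cruxes.TipPricing.CovariantLaplacianFloor

open Matrix
open Literature.Probability.LatticeModels
open Summit.QuantumFields.QCD.Theorems.WindowExtinction.Negative
open scoped Classical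

noncomputable section

/-! ## The one-dimensional tent on `ZMod (2S+1)` -/

/-- Small representatives are their own `valMinAbs`: `((m : ZMod (2S+1))).valMinAbs = m` for
`|m| ≤ S`. -/
theorem ims_valMinAbs_intCast (S : ℕ) (m : ℤ) (hm : |m| ≤ S) :
    ((m : ZMod (2 * S + 1))).valMinAbs = m := by
  rw [ZMod.valMinAbs_spec]
  refine ⟨rfl, ?_⟩
  rw [abs_le] at hm
  rw [Set.mem_Ioc]
  push_cast
  constructor <;> omega

/-- `|valMinAbs z| ≤ S` on `ZMod (2S+1)`. -/
theorem ims_abs_valMinAbs_le (S : ℕ) (z : ZMod (2 * S + 1)) : |z.valMinAbs| ≤ S := by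
  have h := ZMod.natAbs_valMinAbs_le z
  have h2 : (2 * S + 1) / 2 = S := by omega
  rw [h2] at h
  have := Int.ofNat_le.mpr h
  simpa only [Int.natCast_natAbs] using this

/-- The representatives of `z` and `z + 1` differ by at most one in absolute value (`S ≥ 1`). -/
theorem ims_abs_valMinAbs_succ (S : ℕ) (hS : 1 ≤ S) (z : ZMod (2 * S + 1)) :
    |(|(z + 1).valMinAbs| - |z.valMinAbs|)| ≤ 1 := by
  have h1 : ((1 : ZMod (2 * S + 1))).valMinAbs = 1 := by
    have := ims_valMinAbs_intCast S 1 (by rw [abs_one]; exact_mod_cast hS)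
    simpa only [Int.cast_one] using this
  have hm1 : ((-1 : ZMod (2 * S + 1))).valMinAbs = -1 := by
    have := ims_valMinAbs_intCast S (-1) (by rw [abs_neg, abs_one]; exact_mod_cast hS)
    simpa only [Int.cast_neg, Int.cast_one] using this
  have ha := ZMod.natAbs_valMinAbs_add_le z 1
  have hb := ZMod.natAbs_valMinAbs_add_le (z + 1) (-1)
  rw [h1] at ha
  rw [hm1, add_neg_cancel_right] at hb
  have ha' := Int.ofNat_le.mpr ha
  have hb' := Int.ofNat_le.mpr hb
  simp only [Int.natCast_natAbs] at ha' hb'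
  rw [abs_le]
  constructor
  · have := abs_add_le ((z + 1).valMinAbs) (-1)
    rw [abs_neg, abs_one] at this
    linarith
  · have := abs_add_le z.valMinAbs 1
    rw [abs_one] at this
    linarith

/-- The tent `τ(z) = (R + 1 − |z|)₊` is `1`-Lipschitz along `z ↦ z + 1` on `ZMod (2S+1)`. -/
theorem ims_tent_lipschitz (S R : ℕ) (hS : 1 ≤ S) (z : ZMod (2 * S + 1)) :
    |max ((R : ℝ) + 1 - |((z + 1).valMinAbs : ℝ)|) 0 - max ((R : ℝ) + 1 - |(z.valMinAbs : ℝ)|) 0|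
      ≤ 1 := by
  refine (abs_max_sub_max_le_abs _ _ _).trans ?_
  have h := ims_abs_valMinAbs_succ S hS z
  have h' : |(|((z + 1).valMinAbs : ℝ)| - |(z.valMinAbs : ℝ)|)| ≤ 1 := by exact_mod_cast h
  rw [abs_sub_comm] at h'
  have : (R : ℝ) + 1 - |((z + 1).valMinAbs : ℝ)| - ((R : ℝ) + 1 - |(z.valMinAbs : ℝ)|) =
      |(z.valMinAbs : ℝ)| - |((z + 1).valMinAbs : ℝ)| := by ring
  rw [this]
  exact h'

/-- Support of the tent: `τ(z) ≠ 0 → |valMinAbs z| ≤ R`. -/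
theorem ims_abs_le_of_tent_ne_zero {L : ℕ} (R : ℕ) (z : ZMod L)
    (hz : max ((R : ℝ) + 1 - |(z.valMinAbs : ℝ)|) 0 ≠ 0) : |z.valMinAbs| ≤ R := by
  by_contra h
  push Not at h
  have h' : (R : ℤ) + 1 ≤ |z.valMinAbs| := h
  have h'' : (R : ℝ) + 1 ≤ |(z.valMinAbs : ℝ)| := by exact_mod_cast h'
  exact hz (max_eq_right (by linarith))

/-- The tent changes along `z ↦ z + 1` only on the image of `{−(R+1), …, R}`. -/
theorem ims_tent_diff_support (S R : ℕ) (z : ZMod (2 * S + 1))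
    (hz : max ((R : ℝ) + 1 - |((z + 1).valMinAbs : ℝ)|) 0 ≠
      max ((R : ℝ) + 1 - |(z.valMinAbs : ℝ)|) 0) :
    z ∈ (Finset.Icc (-((R : ℤ) + 1)) R).image (Int.cast : ℤ → ZMod (2 * S + 1)) := by
  rw [Finset.mem_image]
  by_cases h0 : max ((R : ℝ) + 1 - |(z.valMinAbs : ℝ)|) 0 = 0
  · rw [h0] at hz
    have h1 := ims_abs_le_of_tent_ne_zero R (z + 1) hz
    rw [abs_le] at h1
    refine ⟨(z + 1).valMinAbs - 1, ?_, ?_⟩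
    · rw [Finset.mem_Icc]; constructor <;> omega
    · rw [Int.cast_sub, ZMod.coe_valMinAbs, Int.cast_one, add_sub_cancel_right]
  · have h1 := ims_abs_le_of_tent_ne_zero R z h0
    rw [abs_le] at h1
    refine ⟨z.valMinAbs, ?_, ZMod.coe_valMinAbs z⟩
    rw [Finset.mem_Icc]; constructor <;> omega

/-- The discrete Dirichlet energy of the tent: `Σ_z (τ(z+1) − τ(z))² ≤ 2R + 2`. -/
theorem ims_tent_energy (S R : ℕ) (hS : 1 ≤ S) :
    ∑ z : ZMod (2 * S + 1), (max ((R : ℝ) + 1 - |((z + 1).valMinAbs : ℝ)|) 0 -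
        max ((R : ℝ) + 1 - |(z.valMinAbs : ℝ)|) 0) ^ 2 ≤ 2 * R + 2 := by
  set T := (Finset.Icc (-((R : ℤ) + 1)) R).image (Int.cast : ℤ → ZMod (2 * S + 1)) with hT
  have hTc : (T.card : ℝ) ≤ 2 * R + 2 := by
    have h1 : T.card ≤ (Finset.Icc (-((R : ℤ) + 1)) R).card := Finset.card_image_le
    rw [Int.card_Icc] at h1
    have h2 : ((R : ℤ) + 1 - -((R : ℤ) + 1)).toNat = 2 * R + 2 := by omega
    rw [h2] at h1
    exact_mod_cast h1
  rw [← Finset.sum_subset (Finset.subset_univ T)]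
  · calc ∑ z ∈ T, (max ((R : ℝ) + 1 - |((z + 1).valMinAbs : ℝ)|) 0 -
          max ((R : ℝ) + 1 - |(z.valMinAbs : ℝ)|) 0) ^ 2 ≤ ∑ z ∈ T, (1 : ℝ) := by
          refine Finset.sum_le_sum fun z _ => ?_
          have h := ims_tent_lipschitz S R hS z
          have h2 := (sq_le_one_iff_abs_le_one _).mpr h
          exact h2
      _ = T.card := by simp
      _ ≤ 2 * R + 2 := hTc
  · intro z _ hz
    have : max ((R : ℝ) + 1 - |((z + 1).valMinAbs : ℝ)|) 0 =
        max ((R : ℝ) + 1 - |(z.valMinAbs : ℝ)|) 0 := by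
      by_contra hne
      exact hz (ims_tent_diff_support S R z hne)
    rw [this, sub_self]
    ring

/-- `n³ ≤ 3 Σ_{j < n} (n − j)²`. -/
theorem ims_cube_le_sum (n : ℕ) :
    (n : ℝ) ^ 3 ≤ 3 * ∑ j ∈ Finset.range n, ((n : ℝ) - j) ^ 2 := by
  induction n with
  | zero => simp
  | succ n ih =>
    rw [Finset.sum_range_succ']
    push_cast
    have : ∑ j ∈ Finset.range n, ((n : ℝ) + 1 - ((j : ℕ) + 1 : ℝ)) ^ 2 =
        ∑ j ∈ Finset.range n, ((n : ℝ) - j) ^ 2 := by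
      refine Finset.sum_congr rfl fun j _ => ?_
      ring
    rw [this]
    have hn : (0 : ℝ) ≤ n := Nat.cast_nonneg n
    nlinarith [ih, hn]

/-- The tent has `ℓ²`-mass at least `(R+1)³/3` (`R + 1 ≤ S`). -/
theorem ims_tent_mass (S R : ℕ) (hRS : R + 1 ≤ S) :
    ((R : ℝ) + 1) ^ 3 / 3 ≤ ∑ z : ZMod (2 * S + 1), (max ((R : ℝ) + 1 - |(z.valMinAbs : ℝ)|) 0) ^ 2 := by
  have hinj : Set.InjOn (Nat.cast : ℕ → ZMod (2 * S + 1)) ↑(Finset.range (R + 1)) := by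
    intro a ha b hb hab
    rw [Finset.coe_range, Set.mem_Iio] at ha hb
    have := (ZMod.natCast_eq_natCast_iff' a b (2 * S + 1)).mp hab
    rwa [Nat.mod_eq_of_lt (by omega), Nat.mod_eq_of_lt (by omega)] at this
  have hval : ∀ j ∈ Finset.range (R + 1),
      (max ((R : ℝ) + 1 - |(((j : ℕ) : ZMod (2 * S + 1)).valMinAbs : ℝ)|) 0) ^ 2 =
        ((((R + 1 : ℕ) : ℝ)) - j) ^ 2 := by
    intro j hj
    rw [Finset.mem_range] at hj
    rw [ZMod.valMinAbs_natCast_of_le_half (by omega)]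
    push_cast
    rw [abs_of_nonneg (by positivity), max_eq_left (by
      have : (j : ℝ) ≤ R := by exact_mod_cast Nat.lt_succ_iff.mp hj
      linarith)]
  calc ((R : ℝ) + 1) ^ 3 / 3 ≤ ∑ j ∈ Finset.range (R + 1), ((((R + 1 : ℕ) : ℝ)) - j) ^ 2 := by
        have := ims_cube_le_sum (R + 1)
        push_cast at this ⊢
        linarith
    _ = ∑ j ∈ Finset.range (R + 1),
          (max ((R : ℝ) + 1 - |(((j : ℕ) : ZMod (2 * S + 1)).valMinAbs : ℝ)|) 0) ^ 2 :=
        (Finset.sum_congr rfl hval).symm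
    _ = ∑ z ∈ (Finset.range (R + 1)).image (Nat.cast : ℕ → ZMod (2 * S + 1)),
          (max ((R : ℝ) + 1 - |(z.valMinAbs : ℝ)|) 0) ^ 2 :=
        (Finset.sum_image (f := fun z : ZMod (2 * S + 1) =>
          (max ((R : ℝ) + 1 - |(z.valMinAbs : ℝ)|) 0) ^ 2) hinj).symm
    _ ≤ _ := Finset.sum_le_univ_sum_of_nonneg fun z => sq_nonneg _

/-- The 1D IMS identity: `2 (Σ τ² − Σ τ(z)τ(z+1)) = Σ (τ(z+1) − τ(z))²`. -/
theorem ims_tent_ims1 {L : ℕ} [NeZero L] (τ : ZMod L → ℝ) :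
    2 * (∑ z, τ z ^ 2 - ∑ z, τ z * τ (z + 1)) = ∑ z, (τ (z + 1) - τ z) ^ 2 := by
  have hshift : ∑ z, τ (z + 1) ^ 2 = ∑ z, τ z ^ 2 :=
    Fintype.sum_equiv (Equiv.addRight 1) _ _ fun z => rfl
  have hexp : ∑ z, (τ (z + 1) - τ z) ^ 2 =
      ∑ z, τ (z + 1) ^ 2 - 2 * ∑ z, τ z * τ (z + 1) + ∑ z, τ z ^ 2 := by
    rw [Finset.mul_sum, ← Finset.sum_sub_distrib, ← Finset.sum_add_distrib]
    refine Finset.sum_congr rfl fun z _ => ?_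
    ring
  rw [hexp, hshift]
  ring

/-- Product weights: `Σ_x ∏_i f_i(x_i) = ∏_i Σ_z f_i(z)` on the torus `(ZMod L)⁴`. -/
theorem ims_sum_prod {L : ℕ} [NeZero L] (f : Fin 4 → ZMod L → ℝ) :
    ∑ x : TorusSite 4 L, ∏ i, f i (x i) = ∏ i, ∑ z, f i z :=
  (Fintype.prod_sum f).symm

/-- **The IMS partition of unity on the torus** (product tent of radius `R` on `(ℤ/(2S+1))⁴`,
`1 ≤ R`, `R + 1 ≤ S`): a real weight `ω` with `Σ ω² > 0`, lattice IMS error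
`0 ≤ Σ_x ω(x)² − Σ_x ω(x)ω(x+e_μ) ≤ (3/R²) Σ_x ω(x)²` in every direction, supported in the image of
the box `{−R,…,R}⁴`. -/
theorem ims_tent (S R : ℕ) (hR : 1 ≤ R) (hRS : R + 1 ≤ S) :
    ∃ ω : TorusSite 4 (2 * S + 1) → ℝ,
      0 < ∑ x, ω x ^ 2 ∧
      (∀ μ : Fin 4, 0 ≤ ∑ x, ω x ^ 2 - ∑ x, ω x * ω (x + Pi.single μ 1) ∧
        ∑ x, ω x ^ 2 - ∑ x, ω x * ω (x + Pi.single μ 1) ≤ 3 / (R : ℝ) ^ 2 * ∑ x, ω x ^ 2) ∧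
      (∀ x, ω x ≠ 0 → ∃ y ∈ box 4 R, Torus.proj (2 * S + 1) y = x) := by
  -- the 1D tent and its sums
  set τ : ZMod (2 * S + 1) → ℝ := fun z => max ((R : ℝ) + 1 - |(z.valMinAbs : ℝ)|) 0 with hτ
  have hS : 1 ≤ S := le_trans (by omega) hRS
  set s2 : ℝ := ∑ z, τ z ^ 2 with hs2
  set p1 : ℝ := ∑ z, τ z * τ (z + 1) with hp1
  have hmass : ((R : ℝ) + 1) ^ 3 / 3 ≤ s2 := ims_tent_mass S R hRS
  have henergy : ∑ z, (τ (z + 1) - τ z) ^ 2 ≤ 2 * R + 2 := ims_tent_energy S R hS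
  have hims1 : 2 * (s2 - p1) = ∑ z, (τ (z + 1) - τ z) ^ 2 := ims_tent_ims1 τ
  have hR0 : (0 : ℝ) < R := by exact_mod_cast hR
  have hs2pos : 0 < s2 := lt_of_lt_of_le (by positivity) hmass
  have hgap0 : 0 ≤ s2 - p1 := by
    have : 0 ≤ ∑ z, (τ (z + 1) - τ z) ^ 2 := Finset.sum_nonneg fun z _ => sq_nonneg _
    linarith
  have hgap : s2 - p1 ≤ 3 / (R : ℝ) ^ 2 * s2 := by
    have h1 : s2 - p1 ≤ (R : ℝ) + 1 := by linarith
    have h2 : ((R : ℝ) + 1) * (R : ℝ) ^ 2 ≤ ((R : ℝ) + 1) ^ 3 := by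
      have : (R : ℝ) ^ 2 ≤ ((R : ℝ) + 1) ^ 2 := by nlinarith
      nlinarith
    rw [div_mul_eq_mul_div, le_div_iff₀ (by positivity)]
    nlinarith
  -- the 4D product tent: mass `s2⁴`, shifted overlap `p1 · s2³`
  have hM : ∑ x : TorusSite 4 (2 * S + 1), (∏ i, τ (x i)) ^ 2 = s2 ^ 4 := by
    simp_rw [← Finset.prod_pow]
    rw [ims_sum_prod (fun _ z => τ z ^ 2), Finset.prod_const, Finset.card_univ, Fintype.card_fin]
  refine ⟨fun x => ∏ i, τ (x i), ?_, fun μ => ?_, fun x hx => ?_⟩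
  · rw [hM]; positivity
  · have hP : ∑ x : TorusSite 4 (2 * S + 1), (∏ i, τ (x i)) *
        ∏ i, τ ((x + (Pi.single μ 1 : TorusSite 4 (2 * S + 1))) i) = p1 * s2 ^ 3 := by
      simp_rw [← Finset.prod_mul_distrib, Pi.add_apply]
      rw [ims_sum_prod (fun i z => τ z * τ (z + (Pi.single μ 1 : TorusSite 4 (2 * S + 1)) i)),
        Fintype.prod_eq_mul_prod_compl μ]
      congr 1
      · rw [hp1]; simp only [Pi.single_eq_same]
      · rw [Finset.prod_congr rfl (g := fun _ => s2)]
        · rw [Finset.prod_const, Finset.card_compl, Fintype.card_fin, Finset.card_singleton]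
        · intro i hi
          rw [Finset.mem_compl, Finset.mem_singleton] at hi
          simp_rw [Pi.single_eq_of_ne hi, add_zero, ← sq]
          rfl
    rw [hM, hP]
    have hfac : s2 ^ 4 - p1 * s2 ^ 3 = s2 ^ 3 * (s2 - p1) := by ring
    rw [hfac]
    refine ⟨by positivity, ?_⟩
    calc s2 ^ 3 * (s2 - p1) ≤ s2 ^ 3 * (3 / (R : ℝ) ^ 2 * s2) :=
          mul_le_mul_of_nonneg_left hgap (by positivity)
      _ = 3 / (R : ℝ) ^ 2 * s2 ^ 4 := by ring
  · -- support
    rw [Finset.prod_ne_zero_iff] at hx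
    refine ⟨fun i => (x i).valMinAbs, ?_, ?_⟩
    · rw [mem_box]
      intro i
      have := ims_abs_le_of_tent_ne_zero R (x i) (hx i (Finset.mem_univ i))
      exact abs_le.mp this
    · funext i
      simp [Torus.proj_apply, ZMod.coe_valMinAbs]

/-! ## Generic quadratic-form facts -/

section Generic

variable {n : Type*} [Fintype n]

/-- `⟨u, Aᴴ u⟩ = conj ⟨u, A u⟩`. -/
theorem ims_form_conjTranspose (A : Matrix n n ℂ) (u : n → ℂ) :
    star u ⬝ᵥ Aᴴ *ᵥ u = star (star u ⬝ᵥ A *ᵥ u) := by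
  rw [mulVec_conjTranspose, star_dotProduct_star, ← dotProduct_mulVec]

/-- `Re⟨u, A u⟩ ≤ ‖u‖²` for an isometry `A`. -/
theorem ims_re_form_le_of_isometry [DecidableEq n] {A : Matrix n n ℂ} (hA : Aᴴ * A = 1)
    (u : n → ℂ) : (star u ⬝ᵥ A *ᵥ u).re ≤ ∑ i, ‖u i‖ ^ 2 := by
  have h := norm_star_dotProduct_le_of_sq_le u (A *ᵥ u) zero_le_one
    (by rw [one_pow, one_mul, sum_norm_sq_mulVec_of_isometry hA])
  rw [one_mul] at h
  exact (Complex.re_le_norm _).trans h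

end Generic

/-! ## Counting by a trace -/

section Count

variable {n : Type*} [Fintype n] [DecidableEq n]

/-- **Trace count.**  If every vector with `Re⟨v, Av⟩ ≤ E‖v‖²` satisfies `c‖v‖² ≤ Σ_i B(i)|v_i|²`
for a non-negative diagonal `B`, then `c · #{eigenvalues of A below E} ≤ Σ_i B(i)` (apply the
hypothesis to the orthonormal eigenvectors and use `Σ_j |e_j(i)|² = 1`). -/
theorem ims_count {A : Matrix n n ℂ} (hA : A.IsHermitian) (E c : ℝ) (B : n → ℝ)
    (hB0 : ∀ i, 0 ≤ B i)
    (hvec : ∀ v : n → ℂ, (star v ⬝ᵥ A *ᵥ v).re ≤ E * ∑ i, ‖v i‖ ^ 2 →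
      c * ∑ i, ‖v i‖ ^ 2 ≤ ∑ i, B i * ‖v i‖ ^ 2) :
    c * ((Finset.univ.filter fun j => hA.eigenvalues j < E).card : ℝ) ≤ ∑ i, B i := by
  set V : Matrix n n ℂ := (hA.eigenvectorUnitary : Matrix n n ℂ) with hV
  have hVV : V * star V = 1 := Matrix.mem_unitaryGroup_iff.mp hA.eigenvectorUnitary.2
  have hVV' : star V * V = 1 := Matrix.mem_unitaryGroup_iff'.mp hA.eigenvectorUnitary.2
  have hrow : ∀ i, ∑ j, ‖V i j‖ ^ 2 = 1 := fun i => by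
    have h := congrFun (congrFun hVV i) i
    rw [Matrix.mul_apply, Matrix.one_apply_eq] at h
    simp only [Matrix.star_apply, Complex.star_def, Complex.mul_conj, Complex.normSq_eq_norm_sq] at h
    exact_mod_cast h
  have hcol : ∀ j, ∑ i, ‖V i j‖ ^ 2 = 1 := fun j => by
    have h := congrFun (congrFun hVV' j) j
    rw [Matrix.mul_apply, Matrix.one_apply_eq] at h
    simp only [Matrix.star_apply, Complex.star_def, Complex.conj_mul'] at h
    exact_mod_cast h
  have hq : ∀ j, (star (fun i => V i j) ⬝ᵥ A *ᵥ fun i => V i j).re = hA.eigenvalues j := fun j => by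
    have h := hA.eigenvalues_eq j
    rw [RCLike.re_to_complex] at h
    exact h.symm
  have hj : ∀ j, hA.eigenvalues j < E → c ≤ ∑ i, B i * ‖V i j‖ ^ 2 := fun j hjE => by
    have h := hvec (fun i => V i j) (by rw [hq j, hcol j, mul_one]; exact hjE.le)
    rwa [hcol j, mul_one] at h
  calc c * ((Finset.univ.filter fun j => hA.eigenvalues j < E).card : ℝ)
      = ∑ j ∈ Finset.univ.filter (fun j => hA.eigenvalues j < E), c := by
        rw [Finset.sum_const, nsmul_eq_mul, mul_comm]
    _ ≤ ∑ j ∈ Finset.univ.filter (fun j => hA.eigenvalues j < E), ∑ i, B i * ‖V i j‖ ^ 2 :=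
        Finset.sum_le_sum fun j hj' => hj j (Finset.mem_filter.mp hj').2
    _ ≤ ∑ j, ∑ i, B i * ‖V i j‖ ^ 2 :=
        Finset.sum_le_univ_sum_of_nonneg fun j => Finset.sum_nonneg fun i _ =>
          mul_nonneg (hB0 i) (sq_nonneg _)
    _ = ∑ i, B i * ∑ j, ‖V i j‖ ^ 2 := by
        rw [Finset.sum_comm]
        refine Finset.sum_congr rfl fun i _ => ?_
        rw [Finset.mul_sum]
    _ = ∑ i, B i := by
        refine Finset.sum_congr rfl fun i _ => ?_
        rw [hrow i, mul_one]

end Count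



/-! ## The registered sub-goal -/

/-- **Registered sub-goal `stub_imsPartition`** (the output of this file consumed by the proof of
`stub_imsColdBoxes`): the IMS partition of unity of radius `R` on the torus of side `2S+1`
(`1 ≤ R`, `R + 1 ≤ S`) with squared-mass `> 0`, IMS error `≤ (3/R²)·mass` in each of the four
directions, supported in the projected box `{−R,…,R}⁴`. -/
theorem stub_imsPartition :
    ∀ (S R : ℕ), 1 ≤ R → R + 1 ≤ S → ∃ ω : TorusSite 4 (2 * S + 1) → ℝ, 0 < ∑ x, ω x ^ 2 ∧
      (∀ μ : Fin 4, 0 ≤ ∑ x, ω x ^ 2 - ∑ x, ω x * ω (x + Pi.single μ 1) ∧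
      ∑ x, ω x ^ 2 - ∑ x, ω x * ω (x + Pi.single μ 1) ≤ 3 / (R : ℝ) ^ 2 * ∑ x, ω x ^ 2) ∧
      ∀ x, ω x ≠ 0 → ∃ y ∈ box 4 R, Torus.proj (2 * S + 1) y = x :=
  fun S R hR hRS => ims_tent S R hR hRS

end

end Summit.QuantumFields.QCD.Cruxes.TipPricing.CovariantLaplacianFloor
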